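import Literature.Computability.QuantumComplexity.ZXCalculusSymmetry
import HarnessLib

/-!
# `ZX_{π/4}` modulo the calculus: block crossings `σₙ,ₘ` and identity casts as morphisms

Topic `Literature/Computability/QuantumComplexity`, continuing `ZXCalculusSymmetry.lean` (layer A4 of
the formalisation of `JeandelPerdrixVilmart2018_completeness`). Two pieces of the strict symmetric
monoidal structure of `ZXClass` that the translations of JPV §5–§6 use constantly:

* **identity casts as morphisms** `ZXClass.ofEq (h : n = n') : ZXClass n n'` (Mathlib's `eqToHom`
  idiom): a cast `A.cast hn hm` is the composite `ofEq hn.symm ⨟ A ⨟ ofEq hm` (`cast_eq_ofEq`), and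
  `ofEq` composes / tensors / flips to `ofEq` (`ofEq_seq_ofEq`, `ofEq_par_ofEq`, `transpose_ofEq`),
  so wire-count bookkeeping becomes ordinary rewriting;
* **the block crossing** `ZXDiagram.bswapN n m : (n + m) → (m + n)` of the last `m` wires over the
  first `n` (`σₙ,ₘ`; JPV's `nmcrossI`), by iterating `bswap1 n`; its unfolding modulo the calculus
  (`bswapN_zero`, `bswapN_succ`, `bswapN_one`, `bswapN_one_left`), invertibility against its flip
  (`bswapN_seq_transpose`, `transpose_seq_bswapN`) and naturality in the crossed-over block
  (`bswapN_nat_left : (A ⊗ 𝕀ᵐ) ⨾ σ = σ ⨾ (𝕀ᵐ ⊗ A)`).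

## References

* P. Selinger, *A survey of graphical languages for monoidal categories* (2010), §3.3–3.5
  [Selinger2010].
* E. Jeandel, S. Perdrix, R. Vilmart, LICS 2018 (arXiv:1705.11151v2), §5.2 (the block crossings in
  the interpretation of `⊗`) [JeandelPerdrixVilmart2018].
-/

noncomputable section

namespace Literature.Computability.QuantumComplexity

open ZXDiagram ZXClass

variable {n m k n' m' k' p q : ℕ}

namespace ZXClass

/-! ### Identity casts as morphisms -/

/-- The identity on `n` wires regarded as a morphism `n → n'` along `h : n = n'` (the `eqToHom`
idiom: casts become composition). [folklore] -/
def ofEq (h : n = n') : ZXClass n n' := (mk (wires n)).cast rfl h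

/-- `ofEq rfl` is the identity. [folklore] -/
@[simp] theorem ofEq_rfl : ofEq (rfl : n = n) = mk (wires n) := rfl

/-- `ofEq` along a reflexive equality, however proved, is the identity. [folklore] -/
theorem ofEq_id (h : n = n) : ofEq h = mk (wires n) := rfl

/-- `ofEq`s compose. [folklore] -/
@[simp] theorem ofEq_seq_ofEq (h : n = n') (h' : n' = k) : ofEq h ⨟ ofEq h' = ofEq (h.trans h') := by
  subst h h'; simp

/-- `ofEq`s compose, with a trailing morphism. [folklore] -/
@[simp] theorem ofEq_seq_ofEq_seq (h : n = n') (h' : n' = k) (A : ZXClass k m) :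
    ofEq h ⨟ (ofEq h' ⨟ A) = ofEq (h.trans h') ⨟ A := by
  rw [← seq_assoc, ofEq_seq_ofEq]

/-- `ofEq`s tensor to an `ofEq`. [folklore] -/
theorem ofEq_par_ofEq (h : n = n') (h' : m = m') :
    ofEq h ⊠ ofEq h' = ofEq (congrArg₂ (· + ·) h h') := by
  subst h h'; simp

/-- The flip of `ofEq h` is `ofEq h.symm`. [folklore] -/
@[simp] theorem transpose_ofEq (h : n = n') : (ofEq h).transpose = ofEq h.symm := by
  subst h; simp

/-- `ofEq` has no colours. [folklore] -/
@[simp] theorem colorSwap_ofEq (h : n = n') : (ofEq h).colorSwap = ofEq h := by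
  subst h; simp

/-- A cast is conjugation by identity casts. [folklore] -/
theorem cast_eq_ofEq (A : ZXClass n m) (hn : n = n') (hm : m = m') :
    A.cast hn hm = ofEq hn.symm ⨟ A ⨟ ofEq hm := by
  subst hn hm; simp

/-- An output cast is a trailing identity cast. [folklore] -/
theorem cast_rfl_eq (A : ZXClass n m) (hm : m = m') : A.cast rfl hm = A ⨟ ofEq hm := by
  subst hm; simp

/-- An input cast is a leading identity cast. [folklore] -/
theorem cast_eq_rfl (A : ZXClass n m) (hn : n = n') : A.cast hn rfl = ofEq hn.symm ⨟ A := by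
  subst hn; simp

/-- Identities tensored with an identity cast give an identity cast. [folklore] -/
theorem wires_par_ofEq (p : ℕ) (h : n = n') :
    mk (wires p) ⊠ ofEq h = ofEq (congrArg (p + ·) h) := by
  subst h; simp

/-- An identity cast tensored with identities gives an identity cast. [folklore] -/
theorem ofEq_par_wires (h : n = n') (p : ℕ) :
    ofEq h ⊠ mk (wires p) = ofEq (congrArg (· + p) h) := by
  subst h; simp

/-- Sliding a morphism past identity casts on disjoint wires (left factor). [folklore] -/
theorem par_ofEq_eq (A : ZXClass n m) (h : k = k') :
    A ⊠ ofEq h = ofEq (congrArg (n + ·) h) ⨟ (A ⊠ mk (wires k')) := by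
  subst h; simp

/-- Sliding a morphism past identity casts on disjoint wires (right factor). [folklore] -/
theorem ofEq_par_eq (h : k = k') (A : ZXClass n m) :
    ofEq h ⊠ A = ofEq (congrArg (· + n) h) ⨟ (mk (wires k') ⊠ A) := by
  subst h; simp

end ZXClass

/-! ### The block crossing -/

namespace ZXDiagram

/-- **The block crossing `σₙ,ₘ : (n + m) → (m + n)`**: the last `m` wires cross over the first `n`
(so that the block of `n` ends up last), obtained by iterating the one-wire crossing `bswap1 n`;
JPV's `⋈`-shaped bundle of crossings in the interpretation of `⊗`. [folklore] -/
def bswapN (n : ℕ) : (m : ℕ) → ZXDiagram (n + m) (m + n)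
  | 0 => (wires n).cast rfl (Nat.zero_add n).symm
  | m + 1 => ((bswapN n m ⊗ wires 1) ⨾ (wires m ⊗ bswap1 n)).cast rfl (Nat.add_assoc m 1 n).symm

/-- Unfolding `σₙ,₀`. [folklore] -/
theorem bswapN_zero_def (n : ℕ) : bswapN n 0 = (wires n).cast rfl (Nat.zero_add n).symm := rfl

/-- Unfolding `σₙ,ₘ₊₁`. [folklore] -/
theorem bswapN_succ_def (n m : ℕ) : bswapN n (m + 1) =
    ((bswapN n m ⊗ wires 1) ⨾ (wires m ⊗ bswap1 n)).cast rfl (Nat.add_assoc m 1 n).symm := rfl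

end ZXDiagram

namespace ZXClass

/-- `σₙ,₀` is an identity cast. [folklore] -/
theorem bswapN_zero (n : ℕ) : mk (bswapN n 0) = ofEq (Nat.zero_add n).symm := by
  rw [bswapN_zero_def, mk_cast]; rfl

/-- `σₙ,ₘ₊₁ = (σₙ,ₘ ⊗ 𝕀) ⨾ (𝕀ᵐ ⊗ χₙ)` followed by an identity cast. [folklore] -/
theorem bswapN_succ (n m : ℕ) : mk (bswapN n (m + 1)) =
    (mk (bswapN n m) ⊠ mk (wires 1)) ⨟ (mk (wires m) ⊠ mk (bswap1 n)) ⨟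
      ofEq (Nat.add_assoc m 1 n).symm := by
  rw [bswapN_succ_def, mk_cast, cast_rfl_eq]; rfl

/-- `σₙ,₁ = χₙ`: crossing a block of one wire is the one-wire crossing. [folklore] -/
@[simp] theorem bswapN_one (n : ℕ) : mk (bswapN n 1) = mk (bswap1 n) := by
  rw [bswapN_succ, bswapN_zero, ofEq_par_wires, empty_par, cast_eq_ofEq]
  simp only [seq_assoc, ofEq_seq_ofEq_seq, ofEq_seq_ofEq, ofEq_id, seq_id, id_seq]

/-- The flip of `σₙ,ₘ₊₁`, unfolded. [folklore] -/
theorem transpose_bswapN_succ (n m : ℕ) : (mk (bswapN n (m + 1))).transpose =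
    ofEq (Nat.add_assoc m 1 n) ⨟ (mk (wires m) ⊠ mk (fswap1 n)) ⨟
      ((mk (bswapN n m)).transpose ⊠ mk (wires 1)) := by
  rw [bswapN_succ]
  simp only [transpose_seq, transpose_par, transpose_ofEq, transpose_mk, transpose_wires,
    transpose_bswap1, seq_assoc]

/-- `σₙ,ₘ` followed by its flip is the identity. [folklore] -/
@[simp] theorem bswapN_seq_transpose (n : ℕ) : (m : ℕ) →
    mk (bswapN n m) ⨟ (mk (bswapN n m)).transpose = mk (wires (n + m))
  | 0 => by rw [bswapN_zero, transpose_ofEq, ofEq_seq_ofEq]; rfl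
  | m + 1 => by
      rw [transpose_bswapN_succ, bswapN_succ]
      simp only [seq_assoc, ofEq_seq_ofEq_seq, ofEq_id, id_seq]
      rw [← seq_assoc (mk (wires m) ⊠ mk (bswap1 n)), interchange, id_seq, bswap1_seq_fswap1,
        wires_par_wires, id_seq, interchange, bswapN_seq_transpose n m, id_seq, wires_par_wires]
      rfl

/-- The flip of `σₙ,ₘ` followed by `σₙ,ₘ` is the identity. [folklore] -/
@[simp] theorem transpose_seq_bswapN (n : ℕ) : (m : ℕ) →
    (mk (bswapN n m)).transpose ⨟ mk (bswapN n m) = mk (wires (m + n))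
  | 0 => by rw [bswapN_zero, transpose_ofEq, ofEq_seq_ofEq]; rfl
  | m + 1 => by
      rw [transpose_bswapN_succ, bswapN_succ]
      simp only [seq_assoc]
      rw [← seq_assoc ((mk (bswapN n m)).transpose ⊠ mk (wires 1)), interchange,
        transpose_seq_bswapN n m, id_seq, wires_par_wires, id_seq,
        ← seq_assoc (mk (wires m) ⊠ mk (fswap1 n)), interchange, id_seq, fswap1_seq_bswap1,
        wires_par_wires, id_seq, ofEq_seq_ofEq, ofEq_id]

/-- Splitting one wire off a block of identities next to a morphism:
`A ⊗ 𝕀ᵐ⁺¹ = (A ⊗ 𝕀ᵐ) ⊗ 𝕀` (the two sides have definitionally equal types). [folklore] -/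
theorem par_wires_succ (A : ZXClass n n') (m : ℕ) :
    A ⊠ mk (wires (m + 1)) = (A ⊠ mk (wires m)) ⊠ mk (wires 1) := by
  rw [← wires_par_wires m 1]
  exact (par_assoc' A (mk (wires m)) (mk (wires 1))).trans (cast_id _ _ _)

/-- Re-bracketing a trailing single wire: `(X ⊗ Y) ⊗ 𝕀 = X ⊗ (Y ⊗ 𝕀)` (definitionally equal
types). [folklore] -/
theorem par_par_wires_one (X : ZXClass n n') (Y : ZXClass m m') :
    (X ⊠ Y) ⊠ mk (wires 1) = X ⊠ (Y ⊠ mk (wires 1)) :=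
  (par_assoc X Y (mk (wires 1))).trans (cast_id _ _ _)

/-- Splitting one wire off a block of identities before a morphism: here the types differ by
associativity, whence the identity casts. [folklore] -/
theorem wires_succ_par (m : ℕ) (A : ZXClass n n') :
    mk (wires (m + 1)) ⊠ A =
      ofEq (Nat.add_assoc m 1 n) ⨟ (mk (wires m) ⊠ (mk (wires 1) ⊠ A)) ⨟
        ofEq (Nat.add_assoc m 1 n').symm := by
  rw [← wires_par_wires m 1, par_assoc, cast_eq_ofEq]

/-- **Naturality of the block crossing in the crossed-over block**:
`(A ⊗ 𝕀ᵐ) ⨾ σ_{n',m} = σ_{n,m} ⨾ (𝕀ᵐ ⊗ A)`. [folklore] -/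
theorem bswapN_nat_left (A : ZXClass n n') : (m : ℕ) →
    (A ⊠ mk (wires m)) ⨟ mk (bswapN n' m) = mk (bswapN n m) ⨟ (mk (wires m) ⊠ A)
  | 0 => by
      rw [bswapN_zero, bswapN_zero, par_empty, empty_par, cast_eq_ofEq]
      simp only [seq_assoc, ofEq_seq_ofEq_seq, ofEq_id, id_seq]
  | m + 1 => by
      rw [bswapN_succ, bswapN_succ, par_wires_succ, wires_succ_par]
      simp only [seq_assoc, ofEq_seq_ofEq_seq, ofEq_id, id_seq]
      rw [← seq_assoc ((A ⊠ mk (wires m)) ⊠ mk (wires 1)), interchange, bswapN_nat_left A m,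
        id_seq, seq_par_wires, seq_assoc, par_par_wires_one,
        ← seq_assoc (mk (wires m) ⊠ (A ⊠ mk (wires 1))), ← wires_par_seq, swap_nat,
        wires_par_seq, seq_assoc]

/-- `σ₁,ₘ` is the crossing of the first wire over the block (`fswap1 m`). [folklore] -/
@[simp] theorem bswapN_one_left : (m : ℕ) → mk (bswapN 1 m) = mk (fswap1 m)
  | 0 => by rw [bswapN_zero, fswap1_zero]; rfl
  | m + 1 => by
      rw [bswapN_succ, bswapN_one_left m, bswap1_one, ofEq_id, seq_id, fswap1_succ, ← mk_seq_mk,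
        ← mk_par_mk, ← mk_par_mk]

end ZXClass

end Literature.Computability.QuantumComplexity
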